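/-
Copyright (c) 2026. Released under Apache 2.0 license.
-/
import Summits.RiemannHypothesis.RiemannHypothesis.Theorems.SemilocalTwoThreeLower8046
import Summits.RiemannHypothesis.RiemannHypothesis.Theorems.GroundBartaEvenWinsBeyondArchEndpointLog5Half
import HarnessLib

/-!
# The semi-local threshold `a*(S)` for `2, 3 ∈ S`: lower end `(log 5)/2` (the coincidence window itself)

Cell `rh-explicit` (HOME `run/shared/lean/pub/rh-explicit/`), seat cc-s2-4 gen8 (consequence filing asked by the lead,
STATUS 2026-08-23T08:48:55Z: «CC lower ends (log 5)/2 for S ⊇ {2,3}»).  Companion of `SemilocalTwoThreeLower8046.lean`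
(cc-s2-2): there the frontier rung `WeilPositivityOn (4023/5000)` of the full Weil ladder was transported to every
`S ∋ 2, 3`, giving `0.8046 ≤ a*(S)`, `1.2·10⁻⁴` short of the coincidence window `(log 5)/2 = 0.80471…` of `{2, 3}`.
The endpoint rung is now a tree theorem — `EvenWinsBeyondArch.weilPositivityOn_log5half :
WeilPositivityOn (Real.log 5 / 2)` (`GroundBartaEvenWinsBeyondArchEndpointLog5Half.lean`, p356973) — and on windows
`a ≤ (log 5)/2` the `S`-smooth semi-local form of an `S ∋ 2, 3` IS the full form (only `2, 3, 4 < e^{2a} ≤ 5` enter;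
`weilSemilocalPositivityOn_iff_weilPositivityOn_of_le`).  Hence, unconditionally:

* `weilSemilocalPositivityOn_log5half`: `WeilSemilocalPositivityOn S ((log 5)/2)` for every finite `S ∋ 2, 3`;
* `log_five_half_le_weilSemilocalThreshold_of_two_three`: **`(log 5)/2 ≤ a*(S)`** — the value that
  `log_five_half_le_weilSemilocalThreshold_of_riemannHypothesis` derived FROM RH is now proved WITHOUT it, so the
  `{2, 3}` door test `not_riemannHypothesis_of_weilSemilocalThreshold_two_three_lt` can no longer fire;
* every bracket `a*(S_q) ∈ [4023/5000, b]` of the A4 SEMILOCAL-TABLE (`SemilocalNegCert*.lean`) sharpens to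
  `[(log 5)/2, b]` (`weilSemilocalThreshold_mem_Icc_log5half_of_le`).

DATA (cell rh-explicit, two engines, kinked sections): `a*({2,3}) ≤ 0.80719896`, i.e. the threshold of `{2,3}` itself
sits `≈ 2.5·10⁻³` above the window; no theorem separates `a*({2,3})` from `(log 5)/2` yet.  Honest framing: theorems
about the TREE's object `weilSemilocalThreshold`; no statement about `ζ`, no RH claim.  Pure proof file (no definitions).
-/

set_option linter.dupNamespace false  -- the mandated namespace repeats `RiemannHypothesis`

noncomputable section

open Real
open Literature.NumberTheory.LFunctions
open Summit.RiemannHypothesis.RiemannHypothesis.Theorems.MotivicDoor.Semilocal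
open Summit.RiemannHypothesis.RiemannHypothesis.Theorems.MotivicDoor.SemilocalThreshold

namespace Summit.RiemannHypothesis.RiemannHypothesis.Theorems.SemilocalTwoThree

variable {S : Finset ℕ}

/-- **`{∞} ∪ S`-positivity on the closed coincidence window `C((log 5)/2)` for every `S ∋ 2, 3`**: there the
semi-local form is the full Weil form and the endpoint rung `WeilPositivityOn ((log 5)/2)` applies.
[cite: Bombieri2000Weil, §4 (criterion); certificate in tree] -/
theorem weilSemilocalPositivityOn_log5half (h2 : 2 ∈ S) (h3 : 3 ∈ S) :
    WeilSemilocalPositivityOn S (Real.log 5 / 2) := by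
  have ha : Real.log 5 / 2 ≤ Real.log (((4 : ℕ) : ℝ) + 1) / 2 := (log_five_half_eq).symm.le
  exact (weilSemilocalPositivityOn_iff_weilPositivityOn_of_le (primeFactors_subset_of_two_three h2 h3) ha).2
    EvenWinsBeyondArch.weilPositivityOn_log5half

/-- … and on every narrower window. [folklore] -/
theorem weilSemilocalPositivityOn_of_le_log5half (h2 : 2 ∈ S) (h3 : 3 ∈ S) {a : ℝ} (ha : a ≤ Real.log 5 / 2) :
    WeilSemilocalPositivityOn S a :=
  (weilSemilocalPositivityOn_log5half h2 h3).mono ha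

/-- **Lower end of every `S ∋ 2, 3` bracket: `(log 5)/2 ≤ a*(S)`** (unconditional; formerly the RH-conditional
`log_five_half_le_weilSemilocalThreshold_of_riemannHypothesis`). [folklore] -/
theorem log_five_half_le_weilSemilocalThreshold_of_two_three (h2 : 2 ∈ S) (h3 : 3 ∈ S) :
    Real.log 5 / 2 ≤ weilSemilocalThreshold S :=
  le_weilSemilocalThreshold (weilSemilocalPositivityOn_log5half h2 h3)

/-- The case `S = {2, 3}` itself: `(log 5)/2 ≤ a*({2,3})`. [folklore] -/
theorem log_five_half_le_weilSemilocalThreshold_two_three :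
    Real.log 5 / 2 ≤ weilSemilocalThreshold ({2, 3} : Finset ℕ) :=
  log_five_half_le_weilSemilocalThreshold_of_two_three (by decide) (by decide)

/-- Decimal form: `0.8047189 < a*(S)` for every finite `S ∋ 2, 3` (`(log 5)/2 = 0.80471895…`). [folklore] -/
theorem weilSemilocalThreshold_gt_d7_of_two_three (h2 : 2 ∈ S) (h3 : 3 ∈ S) :
    (0.8047189 : ℝ) < weilSemilocalThreshold S := by
  have h := log_five_half_le_weilSemilocalThreshold_of_two_three h2 h3
  have h5 := Real.log_five_gt_d9
  linarith

/-- **Bracket form**: an upper end `a*(S) ≤ b` for an `S ∋ 2, 3` gives `a*(S) ∈ [(log 5)/2, b]` — the shape in which the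
A4 SEMILOCAL-TABLE rows (`SemilocalNegCert*.lean`: `weilSemilocalThreshold_le_of_mem_*`) are now read. [folklore] -/
theorem weilSemilocalThreshold_mem_Icc_log5half_of_le (h2 : 2 ∈ S) (h3 : 3 ∈ S) {b : ℝ}
    (hb : weilSemilocalThreshold S ≤ b) : weilSemilocalThreshold S ∈ Set.Icc (Real.log 5 / 2) b :=
  ⟨log_five_half_le_weilSemilocalThreshold_of_two_three h2 h3, hb⟩

/-- The `{2, 3}` door test is closed: NO finite `S ∋ 2, 3` has `a*(S) < (log 5)/2` (so
`not_riemannHypothesis_of_weilSemilocalThreshold_two_three_lt` has no instance). [folklore] -/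
theorem not_weilSemilocalThreshold_lt_log_five_half (h2 : 2 ∈ S) (h3 : 3 ∈ S) :
    ¬ weilSemilocalThreshold S < Real.log 5 / 2 :=
  not_lt.2 (log_five_half_le_weilSemilocalThreshold_of_two_three h2 h3)

end Summit.RiemannHypothesis.RiemannHypothesis.Theorems.SemilocalTwoThree

end
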